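import Mathlib
import Summits.Ventures.PercRepro2.K5Hyper

/-!
# THE `K₅` CERTIFICATE MACHINERY IN BASE `2^28`: THE DEFINITIONS
(blind cell PercRepro2, mine-2 g41, 2026-08-29; for the GENERAL-STAR certificates of the crux kernel `K₃` —
p2's `StarCertsGen`: one certificate per (marking, star list), a placement sum of up to `3^5 = 243` masked
triple counts per side, whose crude bound `243 · 10 · 3^10 ≈ 1.4 · 10^8` exceeds the bases `2^23` of
`K5Hyper.lean` and `2^25` of `K5HyperB25Defs.lean`)

`K5HyperB25Defs.lean` in base `KB8 = 2^28` (mask bit `27`): the tree `go3b8` over the same bit tables, `kron38`,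
`mask8`, `CertLE8`.  Kept import-light (the certificate files import only this and `K5K3Kernel`); the identities
and the digit argument are `K5StarGenB28.lean`.  Own code (typer-1's base-`2^25` text with the constants
changed); standard axioms.
-/

namespace Summit.Ventures.PercRepro2

namespace K5

/-- The base `2^28` of the comparison certificates (digits `< 2^27`). -/
def KB8 : ℕ := 2 ^ 28

/-- The Kronecker tree in base `KB8` of a bit table `B` seen through the forced-open mask `S`
(the leaf reads the bit of `ω ∨ S`). -/
def go3b8 (B : ℕ) (S : Fin 10 → Bool) : ℕ → (Fin 10 → Bool) → ℕ
  | 0, ω => (B.testBit (idx2 (orOn S ω))).toNat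
  | n + 1, ω => go3b8 B S n (Function.update ω (Fin.ofNat 10 n) false) +
      KB8 ^ (4 ^ n) * go3b8 B S n (Function.update ω (Fin.ofNat 10 n) true)

/-- The Kronecker number of the table `T` through the mask `S`, via the bit table. -/
def kron38 (T : (Fin 10 → Bool) → Bool) (S : Fin 10 → Bool) : ℕ := go3b8 (bits T) S 10 (fun _ => false)

/-- The mask: bit `27` of every base-`KB8` digit below `4^10`. -/
def mask8 : ℕ := 2 ^ 27 * ((KB8 ^ (4 ^ 10) - 1) / (KB8 - 1))

/-- The certificate shape: `kNeg ≤ kPos` digitwise, witnessed by `kNeg ≤ kPos` and the two mask tests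
(no borrow anywhere). -/
def CertLE8 (kNeg kPos : ℕ) : Prop :=
  kNeg ≤ kPos ∧ Nat.land (kPos - kNeg) mask8 = 0 ∧ Nat.land kNeg mask8 = 0


end K5

end Summit.Ventures.PercRepro2
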